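import Literature.AnabelianGeometry.EtaleTheta.ThetaCoversTemperedOfSetting
import Literature.AnabelianGeometry.EtaleTheta.Discharge.Sec2BarThetaCommutator
import Literature.AnabelianGeometry.EtaleTheta.Discharge.Sec2AutKDotted
import HarnessLib

/-!
# [EtTh] Remark 2.6.1 HOLDS at the §1 model: the named facts `TemperedCoverData.Rmk261` (FACT-LIST F-0612)
# and — modulo Prop. 2.6 and temp-slimness, BY NAME — `Rmk261_dotted` (F-0613) at the setting-born
# `TemperedCoverData` (proof-only; instance forms at the GENUINE instance)

S. Mochizuki, *The étale theta function and its Frobenioid-theoretic manifestations*, Publ. RIMS **45**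
(2009) [MochizukiEtTh2009], §2, Remark 2.6.1, PRIMS PDF p. 40 (printed p. 266): "Suppose, for simplicity,
that `K` contains a primitive `l`-th root of unity. Then … `Aut_K(X̲̲^log) = μ_l × {±1}`; `Aut_K(X̲^log) =
ℤ/lℤ ⋊ {±1}`; `Aut_K(C̲̲^log) = μ_l`; `Aut_K(C̲^log) = {1}`" and, for the once-dotted curves, "the direct product
of the `Aut_K(−)`'s listed above with `Gal(Ċ^log/C^log) ≅ {±1}`" [cite: MochizukiEtTh2009, Rmk 2.6.1 p.40].

abc-iut cell, block C / F (FACT-PROVING WAVE, tranche 144, seat abc-iut-f-144), rows **F-0612**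
`ThetaCovers.TemperedCoverData.Rmk261` and **F-0613** `ThetaCovers.TemperedCoverData.Rmk261_dotted`
(abc-iut-L2-t2, `ThetaCoversTempered.lean`), `parametrised` schemata over `T : TemperedCoverData l` (FACT-LIST rule
R5: instance forms at NAMED instances; the universal closures are FALSE —
`Discharge/Sec2Rmk261UniversalClosureRefuted.lean`, p432362). PROOF-ONLY companion (0 definitions), composing BY NAME:

* abc-iut-L2-d3's GENUINE instance `MuTwoSetting.CLevelData.temperedCoverData …  : TemperedCoverData l`
  (`ThetaCoversTemperedOfSetting.lean`: the coverings `X̲̲, C̲̲, Y, Ÿ, Ċ` of `C` at the [EtTh] §1 model, profinite part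
  `= PiCData.coverDataAx` of abc-iut-L2-t10, `rfl`);
* abc-iut-L2-t11's THEOREM `ThetaSetting.PiCData.coverDataAx_hTheta` (`Discharge/Sec2BarThetaCommutator.lean`, R158 /
  GAP-LEDGER G-L2d3-1): the binder `hΘ : ⁅Δ_X, Δ_X⁆ · Ker = Δ̄_Θ`-preimage ("`Δ_Θ := Im(∧² Δ^ab_X)`", p. 35) HOLDS at
  every setting-born `CoverDataAx`;
* abc-iut-L2-d3's discharges `TemperedCoverData.rmk261_of` (p419607: `Rmk261` from `hΘ`) and
  `TemperedCoverData.rmk261_dotted_of` (p414899: `Rmk261_dotted` from `IsSlimGroup Π^tp_C`, `Prop26`, `hΘ`).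

RESULTS (for every `MuTwoSetting` `M`, `C`-level datum `e`, profinite completion `ιC : Π^tp_C ↪ P_C`, once-punctured
datum `op`, odd `l`, cusp `x`, and the binders P-C3 `hIx`, P-C4 `hιell`, P-C6 `hS`/`hSc`, P-C7 `hN`/`hY` of the
instance — see `ThetaCoversTemperedOfSetting.lean`):
* `temperedCoverData_hTheta` — `hΘ` for the setting-born `TemperedCoverData` (L2-t11's theorem, re-typed along `rfl`);
* **`rmk261_ofSetting`** — **F-0612 INSTANCE FORM PROVED**: `(e.temperedCoverData …).Rmk261` — `Aut_K(X̲̲) ≅ ℤ/l × ℤ/2`,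
  `Aut_K(X̲) ≅ D_l`, `Aut_K(C̲̲) ≅ ℤ/l`, `Aut_K(C̲) = 1` (given `K ⊇ μ_l`, the antecedent `HasMuL` of the typed row) at the
  §1 model, unconditionally in the instance's own binders;
* **`rmk261_dotted_ofSetting`** — **F-0613 instance form, CONDITIONAL** on the two inputs print itself invokes for the
  dotted curves ("by applying Propositions 2.4, 2.6"): `T.Prop26` (abc-iut-L2-t2's typed [EtTh] Prop. 2.6 = FACT-LIST
  F-0610, BY NAME) and temp-slimness `IsSlimGroup Π^tp_C` ([SemiAnbd] Ex. 3.10, BY NAME).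

HONEST FRAMING: compositions of landed theorems; nothing asserts that a `MuTwoSetting` exists or that Prop. 2.6 /
temp-slimness hold; a FACT row is an assumption label, not an endorsement; nothing bears on [IUTchIII] Cor. 3.12;
no side is taken; typed ≠ proved.
-/

noncomputable section

namespace Literature.AnabelianGeometry.EtaleTheta

open Literature.AnabelianGeometry.SemiGraphs ThetaCovers
open Literature.AlgebraicGeometry.Frobenioids (IsSlimGroup)
open _root_.Topology

namespace MuTwoSetting.CLevelData

variable {p : ℕ} [Fact p.Prime] {M : MuTwoSetting p}
variable {PC : Type} [Group PC] [TopologicalSpace PC] [IsTopologicalGroup PC] [T2Space PC]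

/-- **`hΘ` at the setting-born `TemperedCoverData`**: `⁅Δ_X, Δ_X⁆ ⊔ Ker(Δ_X ↠ Δ̄_X) = Δ̄_Θ`-preimage for
`e.temperedCoverData …` — abc-iut-L2-t11's `PiCData.coverDataAx_hTheta` (GAP G-L2d3-1 proved at settings), transported
along `temperedCoverData_toCoverDataAx` (`rfl`). [cite: MochizukiEtTh2009, Def 2.1 p.35] -/
theorem temperedCoverData_hTheta (e : M.CLevelData) (ιC : M.GtpC →ₜ* PC) (hιC : IsProfiniteCompletion ιC)
    (hinj : Function.Injective ιC) (op : M.toThetaSetting.OncePuncturedData) {l : ℕ} (hodd : Odd l)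
    {x : M.Pt} (hx : M.IsCusp x)
    (hIx : ((e.piCDataOf ιC hιC).Dx x ⊓ (e.piCDataOf ιC hιC).augGK.ker) ⊔ (e.piCDataOf ιC hιC).barKer l =
      (e.piCDataOf ιC hιC).barTheta l)
    (hιell : ∀ c ∈ (e.piCDataOf ιC hιC).augGK.ker, c ∉ (e.piCDataOf ιC hιC).PiX →
      ∀ d ∈ (e.piCDataOf ιC hιC).PiX ⊓ (e.piCDataOf ιC hιC).augGK.ker,
        c * d * c⁻¹ * d ∈ (e.piCDataOf ιC hιC).barTheta l)
    (hN : ((M.GtpXu l).map M.inclX).Normal) (hY : (M.GtpY.map M.inclX).Normal) {S : Subgroup PC}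
    (hS : ((e.piCDataOf ιC hιC).coverDataAx l op hx hodd hIx hιell
        ((e.piCDataOf ιC hιC).inv_theta_of_inv_ell l op hιell)).toCoverData.IsSplitting S)
    (hSc : IsClosed (S : Set PC)) :
    ⁅(e.temperedCoverData ιC hιC hinj op hodd hx hIx hιell hN hY hS hSc).DeltaX,
        (e.temperedCoverData ιC hιC hinj op hodd hx hIx hιell hN hY hS hSc).DeltaX⁆ ⊔
        (e.temperedCoverData ιC hιC hinj op hodd hx hIx hιell hN hY hS hSc).barKer =
      (e.temperedCoverData ιC hιC hinj op hodd hx hIx hιell hN hY hS hSc).barTheta :=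
  (e.piCDataOf ιC hιC).coverDataAx_hTheta l op hx hodd hIx hιell
    ((e.piCDataOf ιC hιC).inv_theta_of_inv_ell l op hιell)

/-- **[EtTh] Remark 2.6.1 HOLDS at the §1 model — FACT-LIST F-0612, INSTANCE FORM PROVED**: abc-iut-L2-t2's named
fact `TemperedCoverData.Rmk261` for the setting-born `e.temperedCoverData …` — given `K ⊇ μ_l` (`HasMuL`),
`Aut_K(X̲̲) ≅ ℤ/l × ℤ/2`, `Aut_K(X̲) ≅ D_l`, `Aut_K(C̲̲) ≅ ℤ/l`, `Aut_K(C̲) = 1` as normaliser quotients in `Π^tp_C` — by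
abc-iut-L2-d3's `rmk261_of` fed with `temperedCoverData_hTheta`. [cite: MochizukiEtTh2009, Rmk 2.6.1 p.40] -/
theorem rmk261_ofSetting (e : M.CLevelData) (ιC : M.GtpC →ₜ* PC) (hιC : IsProfiniteCompletion ιC)
    (hinj : Function.Injective ιC) (op : M.toThetaSetting.OncePuncturedData) {l : ℕ} [NeZero l] (hodd : Odd l)
    {x : M.Pt} (hx : M.IsCusp x)
    (hIx : ((e.piCDataOf ιC hιC).Dx x ⊓ (e.piCDataOf ιC hιC).augGK.ker) ⊔ (e.piCDataOf ιC hιC).barKer l =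
      (e.piCDataOf ιC hιC).barTheta l)
    (hιell : ∀ c ∈ (e.piCDataOf ιC hιC).augGK.ker, c ∉ (e.piCDataOf ιC hιC).PiX →
      ∀ d ∈ (e.piCDataOf ιC hιC).PiX ⊓ (e.piCDataOf ιC hιC).augGK.ker,
        c * d * c⁻¹ * d ∈ (e.piCDataOf ιC hιC).barTheta l)
    (hN : ((M.GtpXu l).map M.inclX).Normal) (hY : (M.GtpY.map M.inclX).Normal) {S : Subgroup PC}
    (hS : ((e.piCDataOf ιC hιC).coverDataAx l op hx hodd hIx hιell
        ((e.piCDataOf ιC hιC).inv_theta_of_inv_ell l op hιell)).toCoverData.IsSplitting S)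
    (hSc : IsClosed (S : Set PC)) :
    (e.temperedCoverData ιC hιC hinj op hodd hx hIx hιell hN hY hS hSc).Rmk261 :=
  (e.temperedCoverData ιC hιC hinj op hodd hx hIx hιell hN hY hS hSc).rmk261_of
    (e.temperedCoverData_hTheta ιC hιC hinj op hodd hx hIx hιell hN hY hS hSc)

/-- **[EtTh] Remark 2.6.1 for the once-dotted curves at the §1 model — FACT-LIST F-0613, instance form, CONDITIONAL**
on [EtTh] Prop. 2.6 (`T.Prop26`, abc-iut-L2-t2's typed named fact F-0610, BY NAME) and temp-slimness of `Π^tp_C`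
(`IsSlimGroup`, [SemiAnbd] Ex. 3.10, BY NAME): abc-iut-L2-t2's `TemperedCoverData.Rmk261_dotted` for the setting-born
`e.temperedCoverData …` — `Aut_K(Ż) ≅ Aut_K(Z) × ℤ/2` for `Z ∈ {X̲̲, X̲, C̲̲, C̲}` — by abc-iut-L2-d3's `rmk261_dotted_of`
fed with `temperedCoverData_hTheta`. [cite: MochizukiEtTh2009, Rmk 2.6.1 p.40] -/
theorem rmk261_dotted_ofSetting (e : M.CLevelData) (ιC : M.GtpC →ₜ* PC) (hιC : IsProfiniteCompletion ιC)
    (hinj : Function.Injective ιC) (op : M.toThetaSetting.OncePuncturedData) {l : ℕ} [NeZero l] (hodd : Odd l)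
    {x : M.Pt} (hx : M.IsCusp x)
    (hIx : ((e.piCDataOf ιC hιC).Dx x ⊓ (e.piCDataOf ιC hιC).augGK.ker) ⊔ (e.piCDataOf ιC hιC).barKer l =
      (e.piCDataOf ιC hιC).barTheta l)
    (hιell : ∀ c ∈ (e.piCDataOf ιC hιC).augGK.ker, c ∉ (e.piCDataOf ιC hιC).PiX →
      ∀ d ∈ (e.piCDataOf ιC hιC).PiX ⊓ (e.piCDataOf ιC hιC).augGK.ker,
        c * d * c⁻¹ * d ∈ (e.piCDataOf ιC hιC).barTheta l)
    (hN : ((M.GtpXu l).map M.inclX).Normal) (hY : (M.GtpY.map M.inclX).Normal) {S : Subgroup PC}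
    (hS : ((e.piCDataOf ιC hιC).coverDataAx l op hx hodd hIx hιell
        ((e.piCDataOf ιC hιC).inv_theta_of_inv_ell l op hιell)).toCoverData.IsSplitting S)
    (hSc : IsClosed (S : Set PC)) (hslim : IsSlimGroup M.GtpC)
    (h26 : (e.temperedCoverData ιC hιC hinj op hodd hx hIx hιell hN hY hS hSc).Prop26) :
    (e.temperedCoverData ιC hιC hinj op hodd hx hIx hιell hN hY hS hSc).Rmk261_dotted :=
  (e.temperedCoverData ιC hιC hinj op hodd hx hIx hιell hN hY hS hSc).rmk261_dotted_of hslim h26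
    (e.temperedCoverData_hTheta ιC hιC hinj op hodd hx hIx hιell hN hY hS hSc)

end MuTwoSetting.CLevelData

end Literature.AnabelianGeometry.EtaleTheta

end
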